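import Mathlib
import Literature.Computability.Complexity.CliqueTestGraphs

/-!
# PneNP / ConvexRankGates — `ConvexGateBlind`, helper: one non-negative threshold certificate
rejects exponentially few colouring graphs

Helpers (`--supports stmt-PneNP-10680`) toward the crux `ConvexGateBlind` of route `ConvexRankGates`.
A rejecting certificate of a (diagonal / LP-type) CONV gate is a non-negative edge weighting `w` with a
threshold `θ` such that every accepted input has weight `≥ θ`; the intended lower-bound method counts
how many NEGATIVE test inputs one certificate can reject. Here the negatives are Razborov's colouring
graphs `G_h` (complete `(k-1)`-partite graphs of colourings `h : Fin m → Fin (k-1)`, `colorVec h`) and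
the positives the bare `k`-cliques (`cliqueVec Q`, `#Q = k`). We prove:

* `exists_heavy_edge_of_le_sum` — if `θ ≤ w(E(Q))` then `Q` spans an edge of weight `≥ θ / k²`.
* `card_colorings_sum_lt_le` — if `w ≥ 0`, `θ > 0` and `θ ≤ w(E(Q))` for every `k`-set `Q`, then the
  number of colourings `h` with `w(G_h) < θ` is at most `k² · (m/k + 1)^{k²} · (k-1)^{m - m/k + k²}`,
  an exponentially small fraction of all `(k-1)^m` colourings as soon as `k³ ≪ m`.
  Proof: cut `Fin m` into `m/k` blocks of `k` consecutive vertices; each block spans a heavy edge, and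
  these edges are pairwise disjoint; a colouring with `w(G_h) < θ` makes fewer than `k²` of them
  bichromatic; colourings monochromatic on a prescribed set of `r` disjoint pairs number `(k-1)^{m-r}`.

Nothing here is specific to SDP gates; the file is pure counting over the clique/colouring test graphs.
-/

namespace Summit.PneNP.PneNP.Theorems

open Finset Literature.Computability.Complexity

/-- Every unordered pair is `s(a, b)` for some `a, b`. [folklore] -/
theorem sym2_exists_eq_mk {α : Type*} (z : Sym2 α) : ∃ a b : α, z = s(a, b) :=
  Sym2.ind (fun a b => ⟨a, b, rfl⟩) z

/-- **A heavy edge inside a heavy set.** If the edges spanned by a `k`-set `Q` carry total weight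
`≥ θ > 0`, one of them carries weight `≥ θ / k²` (there are at most `C(k+1, 2) ≤ k²` of them). [folklore] -/
theorem exists_heavy_edge_of_le_sum {m k : ℕ} (w : (⊤ : SimpleGraph (Fin m)).edgeSet → ℝ) {θ : ℝ}
    (hθ : 0 < θ) (Q : Finset (Fin m)) (hQk : Q.card = k)
    (hQ : θ ≤ ∑ e, if cliqueVec Q e = true then w e else 0) :
    ∃ e : (⊤ : SimpleGraph (Fin m)).edgeSet, (∀ v ∈ (e : Sym2 (Fin m)), v ∈ Q) ∧ θ / (k : ℝ) ^ 2 ≤ w e := by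
  classical
  by_contra hcon
  push Not at hcon
  set EQ := (univ.filter fun e : (⊤ : SimpleGraph (Fin m)).edgeSet => ∀ v ∈ (e : Sym2 (Fin m)), v ∈ Q)
    with hEQ
  have hsum : (∑ e, if cliqueVec Q e = true then w e else 0) = ∑ e ∈ EQ, w e := by
    rw [hEQ, Finset.sum_filter]
    refine Finset.sum_congr rfl fun e _ => ?_
    simp only [cliqueVec, decide_eq_true_eq]
  -- at most `C(k+1, 2) ≤ k²` edges are spanned by `Q`
  have hcard : EQ.card ≤ k ^ 2 := by
    have h1 : (EQ.map ⟨Subtype.val, Subtype.val_injective⟩).card ≤ Q.sym2.card := by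
      refine Finset.card_le_card fun z hz => ?_
      obtain ⟨e, he, rfl⟩ := Finset.mem_map.1 hz
      exact Finset.mem_sym2_iff.2 (Finset.mem_filter.1 he).2
    rw [Finset.card_map, Finset.card_sym2, hQk, Nat.choose_two_right] at h1
    have h2 : (k + 1) * (k + 1 - 1) / 2 ≤ k ^ 2 := by
      apply Nat.div_le_of_le_mul
      have : (k + 1) * k ≤ 2 * k ^ 2 := by nlinarith
      simpa using this
    exact h1.trans h2
  rcases EQ.eq_empty_or_nonempty with h0 | hne
  · rw [hsum, h0, Finset.sum_empty] at hQ
    exact absurd hQ (not_le.2 hθ)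
  · -- `k ≥ 1`: an edge spanned by `Q` has an endpoint in `Q`
    have hk : 1 ≤ k := by
      obtain ⟨e, he⟩ := hne
      obtain ⟨a, b, hab⟩ := sym2_exists_eq_mk (e : Sym2 (Fin m))
      have ha : a ∈ Q := (Finset.mem_filter.1 he).2 a (by rw [hab]; exact Sym2.mem_mk_left a b)
      rw [← hQk]
      exact Finset.card_pos.2 ⟨a, ha⟩
    have hlt : ∑ e ∈ EQ, w e < ∑ e ∈ EQ, θ / (k : ℝ) ^ 2 :=
      Finset.sum_lt_sum_of_nonempty hne fun e he => hcon e (Finset.mem_filter.1 he).2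
    rw [Finset.sum_const, nsmul_eq_mul] at hlt
    have hk2 : (0 : ℝ) < (k : ℝ) ^ 2 := by positivity
    have hle : (EQ.card : ℝ) * (θ / (k : ℝ) ^ 2) ≤ θ := by
      calc (EQ.card : ℝ) * (θ / (k : ℝ) ^ 2) ≤ ((k : ℝ) ^ 2) * (θ / (k : ℝ) ^ 2) := by
            gcongr
            exact_mod_cast hcard
        _ = θ := by field_simp
    rw [hsum] at hQ
    linarith

/-- The `i`-th block of `k` consecutive vertices `{i k, …, i k + k - 1}` of `Fin m` (`i < m / k`) has
exactly `k` elements. [folklore] -/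
theorem card_filter_div_eq {m k : ℕ} (hk : 0 < k) (i : Fin (m / k)) :
    (univ.filter fun v : Fin m => (v : ℕ) / k = i).card = k := by
  have hlt : ∀ j : Fin k, (i : ℕ) * k + j < m := by
    intro j
    have h1 : ((i : ℕ) + 1) * k ≤ (m / k) * k := Nat.mul_le_mul_right k i.isLt
    have h2 : (m / k) * k ≤ m := Nat.div_mul_le_self m k
    have h3 : (i : ℕ) * k + j < ((i : ℕ) + 1) * k := by
      have := j.isLt
      nlinarith
    omega
  let ι : Fin k ↪ Fin m := ⟨fun j => ⟨(i : ℕ) * k + j, hlt j⟩, fun j j' h => by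
    apply Fin.ext
    have := Fin.mk.inj_iff.1 h
    omega⟩
  have hset : (univ.filter fun v : Fin m => (v : ℕ) / k = i) = (univ : Finset (Fin k)).map ι := by
    ext v
    simp only [Finset.mem_filter, Finset.mem_univ, true_and, Finset.mem_map, ι,
      Function.Embedding.coeFn_mk]
    constructor
    · intro hv
      refine ⟨⟨(v : ℕ) % k, Nat.mod_lt _ hk⟩, ?_⟩
      apply Fin.ext
      simp only
      have := Nat.div_add_mod (v : ℕ) k
      rw [hv] at this
      linarith
    · rintro ⟨j, rfl⟩
      simp only
      rw [Nat.add_comm, Nat.add_mul_div_right _ _ hk, Nat.div_eq_of_lt j.isLt, Nat.zero_add]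
  rw [hset, Finset.card_map, Finset.card_univ, Fintype.card_fin]

/-- **One threshold certificate rejects exponentially few colourings.** Let `w ≥ 0` be an edge
weighting of `K_m` and `θ > 0` a threshold such that every `k`-set spans weight `≥ θ` (`k ≥ 2`). Then
the colourings `h : Fin m → Fin (k-1)` whose bichromatic edges (the complete `(k-1)`-partite graph
`G_h = colorVec h`, a `k`-clique-free graph) weigh `< θ` — i.e. the colouring negatives rejected by the
certificate `(w, θ)` — number at most `k² · (m/k + 1)^{k²} · (k-1)^{m - m/k + k²}` out of `(k-1)^m`.
Proof: each of the `m/k` blocks of `k` consecutive vertices spans an edge of weight `≥ θ/k²`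
(`exists_heavy_edge_of_le_sum`); these block edges are pairwise vertex-disjoint; if `w(G_h) < θ` then
fewer than `k²` of them are bichromatic; and the colourings monochromatic on all block edges outside an
exceptional index set `T` inject into the colourings of the `m - (m/k - #T)` vertices that are not the
second endpoint of a non-exceptional block edge. [folklore] -/
theorem card_colorings_sum_lt_le {m k : ℕ} (hk : 2 ≤ k)
    (w : (⊤ : SimpleGraph (Fin m)).edgeSet → ℝ) (hw : ∀ e, 0 ≤ w e) {θ : ℝ} (hθ : 0 < θ)
    (hQ : ∀ Q : Finset (Fin m), Q.card = k → θ ≤ ∑ e, if cliqueVec Q e = true then w e else 0) :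
    (univ.filter fun h : Fin m → Fin (k - 1) =>
        (∑ e, if colorVec h e = true then w e else 0) < θ).card
      ≤ k ^ 2 * (m / k + 1) ^ (k ^ 2) * (k - 1) ^ (m - m / k + k ^ 2) := by
  classical
  have hk0 : 0 < k := by omega
  set μ := m / k with hμ
  -- blocks of `k` consecutive vertices
  let blk : Fin μ → Finset (Fin m) := fun i => univ.filter fun v : Fin m => (v : ℕ) / k = i
  have mem_blk : ∀ (i : Fin μ) (v : Fin m), v ∈ blk i ↔ (v : ℕ) / k = i := fun i v => by
    simp only [blk, Finset.mem_filter, Finset.mem_univ, true_and]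
  have card_blk : ∀ i : Fin μ, (blk i).card = k := fun i => card_filter_div_eq hk0 i
  have blk_inj : ∀ {i j : Fin μ} {v : Fin m}, v ∈ blk i → v ∈ blk j → i = j := by
    intro i j v hi hj
    rw [mem_blk] at hi hj
    exact Fin.ext (by rw [← hi, ← hj])
  -- a heavy edge in every block
  have hex : ∀ i : Fin μ, ∃ e : (⊤ : SimpleGraph (Fin m)).edgeSet,
      (∀ v ∈ (e : Sym2 (Fin m)), v ∈ blk i) ∧ θ / (k : ℝ) ^ 2 ≤ w e :=
    fun i => exists_heavy_edge_of_le_sum w hθ (blk i) (card_blk i) (hQ _ (card_blk i))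
  choose f hfblk hfw using hex
  -- endpoints `a i ≠ b i` of the block edges
  have hend : ∀ i : Fin μ, ∃ ab : Fin m × Fin m, (f i : Sym2 (Fin m)) = s(ab.1, ab.2) ∧ ab.1 ≠ ab.2 := by
    intro i
    obtain ⟨a, b, hab⟩ := sym2_exists_eq_mk (f i : Sym2 (Fin m))
    refine ⟨(a, b), hab, ?_⟩
    have hmem := (f i).2
    rw [hab, SimpleGraph.mem_edgeSet, SimpleGraph.top_adj] at hmem
    exact hmem
  choose ab hab hne using hend
  have ha_blk : ∀ i, (ab i).1 ∈ blk i := fun i =>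
    hfblk i _ (by rw [hab i]; exact Sym2.mem_mk_left _ _)
  have hb_blk : ∀ i, (ab i).2 ∈ blk i := fun i =>
    hfblk i _ (by rw [hab i]; exact Sym2.mem_mk_right _ _)
  have f_inj : Function.Injective f := by
    intro i j hij
    have h1 : (ab i).1 ∈ blk j := hfblk j _ (by rw [← hij, hab i]; exact Sym2.mem_mk_left _ _)
    exact blk_inj (ha_blk i) h1
  have b_inj : Function.Injective fun i => (ab i).2 := by
    intro i j hij
    have h1 : (ab i).2 ∈ blk j := by
      have := hb_blk j
      simp only at hij
      rw [← hij] at this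
      exact this
    exact blk_inj (hb_blk i) h1
  have a_ne_b : ∀ i j, (ab i).1 ≠ (ab j).2 := by
    intro i j h
    have hij : i = j := blk_inj (ha_blk i) (by rw [h]; exact hb_blk j)
    subst hij
    exact hne i h
  -- monochromatic block edge `i` under `h`
  have color_ff : ∀ (h : Fin m → Fin (k - 1)) (i : Fin μ),
      colorVec h (f i) = false ↔ h (ab i).1 = h (ab i).2 := by
    intro h i
    simp only [colorVec, Bool.not_eq_false', decide_eq_true_eq]
    rw [hab i, Sym2.map_mk, Sym2.mk_isDiag_iff]
  -- Step 1: a rejected colouring makes fewer than `k²` block edges bichromatic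
  have few : ∀ h : Fin m → Fin (k - 1), (∑ e, if colorVec h e = true then w e else 0) < θ →
      (univ.filter fun i : Fin μ => colorVec h (f i) = true).card < k ^ 2 := by
    intro h hbad
    set Bi := univ.filter fun i : Fin μ => colorVec h (f i) = true with hBi
    have h1 : (Bi.card : ℝ) * (θ / (k : ℝ) ^ 2) ≤ ∑ i ∈ Bi, w (f i) := by
      rw [← nsmul_eq_mul, ← Finset.sum_const]
      exact Finset.sum_le_sum fun i _ => hfw i
    have h2 : ∑ i ∈ Bi, w (f i) ≤ ∑ e, if colorVec h e = true then w e else 0 := by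
      rw [← Finset.sum_image (g := f) (f := fun e => w e) fun i _ j _ hij => f_inj hij,
        ← Finset.sum_filter]
      apply Finset.sum_le_sum_of_subset_of_nonneg
      · intro e he
        obtain ⟨i, hi, rfl⟩ := Finset.mem_image.1 he
        exact Finset.mem_filter.2 ⟨Finset.mem_univ _, (Finset.mem_filter.1 hi).2⟩
      · intro e _ _
        exact hw e
    have hk2 : (0 : ℝ) < (k : ℝ) ^ 2 := by positivity
    have h3 : (Bi.card : ℝ) < (k : ℝ) ^ 2 := by
      by_contra hcon
      push Not at hcon
      have h4 : ((k : ℝ) ^ 2) * (θ / (k : ℝ) ^ 2) ≤ (Bi.card : ℝ) * (θ / (k : ℝ) ^ 2) := by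
        gcongr
      have h5 : ((k : ℝ) ^ 2) * (θ / (k : ℝ) ^ 2) = θ := by field_simp
      linarith
    exact_mod_cast h3
  -- Step 2: colourings monochromatic on the block edges outside `T`
  have card_M : ∀ T : Finset (Fin μ),
      (univ.filter fun h : Fin m → Fin (k - 1) => ∀ i, i ∉ T → colorVec h (f i) = false).card
        ≤ (k - 1) ^ (m - (μ - T.card)) := by
    intro T
    set BT := (univ \ T).image fun i => (ab i).2 with hBT
    have cardBT : BT.card = μ - T.card := by
      rw [hBT, Finset.card_image_of_injective _ b_inj, Finset.card_sdiff_of_subset (Finset.subset_univ T),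
        Finset.card_univ, Fintype.card_fin]
    have ha : ∀ i, (ab i).1 ∉ BT := by
      intro i hmem
      obtain ⟨j, _, hj⟩ := Finset.mem_image.1 hmem
      exact a_ne_b i j hj.symm
    set M := univ.filter fun h : Fin m → Fin (k - 1) => ∀ i, i ∉ T → colorVec h (f i) = false with hM
    let φ : {h : Fin m → Fin (k - 1) // h ∈ M} → ({v : Fin m // v ∉ BT} → Fin (k - 1)) :=
      fun h v => h.1 v.1
    have φ_inj : Function.Injective φ := by
      rintro ⟨h, hh⟩ ⟨h', hh'⟩ heq
      have hh1 := (Finset.mem_filter.1 hh).2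
      have hh1' := (Finset.mem_filter.1 hh').2
      apply Subtype.ext
      funext v
      show h v = h' v
      by_cases hv : v ∈ BT
      · obtain ⟨i, hi, rfl⟩ := Finset.mem_image.1 hv
        have hiT : i ∉ T := (Finset.mem_sdiff.1 hi).2
        have e1 : h (ab i).1 = h (ab i).2 := (color_ff h i).1 (hh1 i hiT)
        have e2 : h' (ab i).1 = h' (ab i).2 := (color_ff h' i).1 (hh1' i hiT)
        have e3 := congrFun heq ⟨(ab i).1, ha i⟩
        simp only [φ] at e3
        rw [← e1, ← e2]
        exact e3
      · exact congrFun heq ⟨v, hv⟩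
    have hle := Fintype.card_le_of_injective φ φ_inj
    rw [Fintype.card_coe] at hle
    refine hle.trans (le_of_eq ?_)
    rw [Fintype.card_fun, Fintype.card_fin, Fintype.card_subtype_compl, Fintype.card_fin,
      Fintype.card_coe, cardBT]
  -- Step 3: cover the rejected colourings by the sets of Step 2 over the exceptional sets `T`, `#T < k²`
  set Bad := univ.filter fun h : Fin m → Fin (k - 1) =>
    (∑ e, if colorVec h e = true then w e else 0) < θ with hBad
  set Ts := (univ : Finset (Fin μ)).powerset.filter fun T => T.card < k ^ 2 with hTs
  have cover : Bad ⊆ Ts.biUnion fun T =>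
      univ.filter fun h : Fin m → Fin (k - 1) => ∀ i, i ∉ T → colorVec h (f i) = false := by
    intro h hh
    rw [Finset.mem_biUnion]
    refine ⟨univ.filter fun i => colorVec h (f i) = true, ?_, ?_⟩
    · exact Finset.mem_filter.2 ⟨Finset.mem_powerset.2 (Finset.filter_subset _ _),
        few h (Finset.mem_filter.1 hh).2⟩
    · refine Finset.mem_filter.2 ⟨Finset.mem_univ _, fun i hi => ?_⟩
      simpa using hi
  have cardTs : Ts.card ≤ k ^ 2 * (μ + 1) ^ (k ^ 2) := by
    have hsub : Ts ⊆ (range (k ^ 2)).biUnion fun j => powersetCard j (univ : Finset (Fin μ)) := by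
      intro T hT
      rw [Finset.mem_biUnion]
      exact ⟨T.card, Finset.mem_range.2 (Finset.mem_filter.1 hT).2,
        Finset.mem_powersetCard.2 ⟨Finset.subset_univ _, rfl⟩⟩
    refine (Finset.card_le_card hsub).trans (Finset.card_biUnion_le.trans ?_)
    calc ∑ j ∈ range (k ^ 2), (powersetCard j (univ : Finset (Fin μ))).card
        = ∑ j ∈ range (k ^ 2), μ.choose j := by
          refine Finset.sum_congr rfl fun j _ => ?_
          rw [Finset.card_powersetCard, Finset.card_univ, Fintype.card_fin]
      _ ≤ ∑ _j ∈ range (k ^ 2), (μ + 1) ^ (k ^ 2) := by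
          refine Finset.sum_le_sum fun j hj => ?_
          calc μ.choose j ≤ μ ^ j := Nat.choose_le_pow _ _
            _ ≤ (μ + 1) ^ j := Nat.pow_le_pow_left (Nat.le_succ μ) j
            _ ≤ (μ + 1) ^ (k ^ 2) := Nat.pow_le_pow_right (Nat.succ_pos μ) (Finset.mem_range.1 hj).le
      _ = k ^ 2 * (μ + 1) ^ (k ^ 2) := by
          rw [Finset.sum_const, Finset.card_range, smul_eq_mul]
  have hk1 : 0 < k - 1 := by omega
  calc Bad.card
      ≤ (Ts.biUnion fun T => univ.filter fun h : Fin m → Fin (k - 1) =>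
          ∀ i, i ∉ T → colorVec h (f i) = false).card := Finset.card_le_card cover
    _ ≤ ∑ T ∈ Ts, (univ.filter fun h : Fin m → Fin (k - 1) =>
          ∀ i, i ∉ T → colorVec h (f i) = false).card := Finset.card_biUnion_le
    _ ≤ ∑ _T ∈ Ts, (k - 1) ^ (m - μ + k ^ 2) := by
        refine Finset.sum_le_sum fun T hT => (card_M T).trans (Nat.pow_le_pow_right hk1 ?_)
        have := (Finset.mem_filter.1 hT).2
        omega
    _ = Ts.card * (k - 1) ^ (m - μ + k ^ 2) := by rw [Finset.sum_const, smul_eq_mul]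
    _ ≤ k ^ 2 * (μ + 1) ^ (k ^ 2) * (k - 1) ^ (m - μ + k ^ 2) := Nat.mul_le_mul_right _ cardTs

end Summit.PneNP.PneNP.Theorems
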